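import Summits.ValiantsHypothesis.ValiantsHypothesis.Theorems.FifoMatchingNNDivisionHardSwitchedFaceTowerZonotope
import HarnessLib

/-!
# The SWITCHED-FACE RUNGS, part 4: the TOLERANT located read (fibre of any size) and the (half-)MOVE-STABLE self-similar form (§8–§9)

Theorems-side TRANSPLANT (port hand val-port-1 g3; crit-9 g1 CONFIRM 21:07:55Z «P-P2a′», director R298 (2), desk RULING #347 (A);
`--supports stmt-ValiantsHypothesis-21181 --as helper`) of val-idea-38 g1's crux workfile `Cruxes/NNDivisionHard/SwitchFaceTowerRung.lean`
REV 4 FINAL @27833a3f9586 (sha16 9555358f6f12b67d, 909 l.; farm rc 0 / 0 sorry / 0 warnings; crit-9 g1 re-probes of rev 3 VERIFIED, axioms std)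
— texts VERBATIM, namespace moved `…Cruxes.NNDivisionHard.SwitchFace` ↦ `…Theorems.FifoMatching.SwitchFace`, the 909-line file split by the
400-line cap into four modules `…SwitchedFaceTower(Face | · | Zonotope | Tolerant).lean` (§1–§3 / §4–§6 / §7 / §8–§9).  This module: §8 `located_face_read`, `switchExposedFibre_three_pow_le`; §9 `hasEF_cor_of_selfSimilar`, `switchLocated_selfSimilar_rung`.
Credit: statements + proofs val-idea-38 g1 (W5-P2, card `Cruxes/NNDivisionHard/Ideas/switched-face-psd-free.md`); critic of record val-idea-crit-9 g1.
HONEST FRAMING: kernel food for an OPEN crux — located-point / switched-face certificates decide CLASSES of passengers (every 0-1 rank-one tower,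
`COR − COR`, ±PSD zonotopes, self-similar read fibres) at the Kaibel–Weltge rate; stmt-21181 `NNDivisionHard` OPEN; COR-VIRTUAL OPEN;
`VP ≠ VNP` NOT proved; nothing here is a summit statement.
-/

set_option autoImplicit false

-- the mandated summit-side namespace repeats a component by design (single-problem summit)
set_option linter.dupNamespace false

noncomputable section

open Matrix Finset
open scoped Pointwise

namespace Summit.ValiantsHypothesis.ValiantsHypothesis.Theorems.FifoMatching.SwitchFace

open Literature.Barriers.PneNP (HasEFOfSize)
open Literature.Combinatorics.Optimization (corPolytopeGraph corVec)
open Summit.ValiantsHypothesis.ValiantsHypothesis.Theorems.FifoMatching.XcDivision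
  (dot_le_of_mem_convexHull convexHull_range_inter_eq corVec_top_apply corPolytopeGraph_top_add_hull_three_pow_le)

variable {n : ℕ}

/-! ## §8 The TOLERANT form: the located READ at `F_a` for a fibre of ANY size (composable with PROP A / class D downstream) -/

/-- ★★ **THE LOCATED READ** (tolerant engine): for `C` valid on `COR(K_{n+1})` and tight exactly on `F_a`, an EF of
`COR(K_{n+1}) + conv{q j}` of size `r` yields an EF of size `r` of `COR(K_n) + conv{read(q j − q j₀) : j a C-maximiser}` —
the passenger is replaced by the deletion read of its `C`-fibre.  (`located_point_rung` is the case of a one-point fibre.) -/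
theorem located_face_read {J : Type} (a : Fin (n + 1)) (C : Fin (n + 1) × Fin (n + 1) → ℝ) (M : ℝ)
    (valid : ∀ b : Fin (n + 1) → Bool, C ⬝ᵥ corVec (⊤ : SimpleGraph (Fin (n + 1))) b ≤ M)
    (tight : ∀ b : Fin (n + 1) → Bool, C ⬝ᵥ corVec (⊤ : SimpleGraph (Fin (n + 1))) b = M ↔ b a = true)
    (q : J → (Fin (n + 1) × Fin (n + 1) → ℝ)) (j₀ : J) (hmax : ∀ j, C ⬝ᵥ q j ≤ C ⬝ᵥ q j₀) (r : ℕ)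
    (h : HasEFOfSize (corPolytopeGraph (⊤ : SimpleGraph (Fin (n + 1))) + convexHull ℝ (Set.range q)) r) :
    HasEFOfSize (corPolytopeGraph (⊤ : SimpleGraph (Fin n)) +
      convexHull ℝ (Set.range fun j : {j : J // C ⬝ᵥ q j = C ⬝ᵥ q j₀} => delRead n a (q j.1 - q j₀))) r := by
  have hP : ∀ x ∈ corPolytopeGraph (⊤ : SimpleGraph (Fin (n + 1))), C ⬝ᵥ x ≤ M :=
    dot_le_of_mem_convexHull _ _ _ (by rintro _ ⟨b, rfl⟩; exact valid b)
  have hQ : ∀ y ∈ convexHull ℝ (Set.range q), C ⬝ᵥ y ≤ C ⬝ᵥ q j₀ :=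
    dot_le_of_mem_convexHull _ _ _ (by rintro _ ⟨j, rfl⟩; exact hmax j)
  -- the located face of the sum: `F_a + conv(fibre)`
  have h1 := h.face_add_face₁ C M (C ⬝ᵥ q j₀) hP hQ
  rw [convexHull_range_inter_eq q C _ hmax, cor_face_eq' valid] at h1
  -- translate the fibre back by `−q j₀`
  have h2 := h1.image_add_const (-q j₀)
  rw [← Set.add_singleton, add_assoc, ← convexHull_singleton (𝕜 := ℝ), ← convexHull_add, Set.add_singleton,
    ← Set.range_comp] at h2
  -- read through the deletion map (linear: sum ↦ sum, hull ↦ hull)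
  have h3 := h2.image_linearMap (delRead n a)
  rw [Set.image_add, delRead_face a tight, LinearMap.image_convexHull, ← Set.range_comp] at h3
  have hfun : (⇑(delRead n a) ∘ ((fun x => x + -q j₀) ∘ fun j : {j : J // C ⬝ᵥ q j = C ⬝ᵥ q j₀} => q j.1)) =
      fun j : {j : J // C ⬝ᵥ q j = C ⬝ᵥ q j₀} => delRead n a (q j.1 - q j₀) := by
    funext j
    simp only [Function.comp_apply, sub_eq_add_neg]
  rwa [hfun] at h3

/-- ★ COROLLARY (tolerant `SwitchExposed`, composed with PROP A ✓ `corPolytopeGraph_top_add_hull_three_pow_le`): if the `C`-fibre of the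
passenger is spanned by `K` maximising generators then `3^n ≤ K·(r+1)·2^n` — e.g. a tower plus `k` extra `F_a`-aligned zones is decided
while `k = o(n)`. -/
theorem switchExposedFibre_three_pow_le {J : Type} [Fintype J] (a : Fin (n + 1)) (C : Fin (n + 1) × Fin (n + 1) → ℝ) (M : ℝ)
    (valid : ∀ b : Fin (n + 1) → Bool, C ⬝ᵥ corVec (⊤ : SimpleGraph (Fin (n + 1))) b ≤ M)
    (tight : ∀ b : Fin (n + 1) → Bool, C ⬝ᵥ corVec (⊤ : SimpleGraph (Fin (n + 1))) b = M ↔ b a = true)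
    (q : J → (Fin (n + 1) × Fin (n + 1) → ℝ)) (j₀ : J) (hmax : ∀ j, C ⬝ᵥ q j ≤ C ⬝ᵥ q j₀) (r : ℕ)
    (h : HasEFOfSize (corPolytopeGraph (⊤ : SimpleGraph (Fin (n + 1))) + convexHull ℝ (Set.range q)) r) :
    3 ^ n ≤ Nat.card {j : J // C ⬝ᵥ q j = C ⬝ᵥ q j₀} * (r + 1) * 2 ^ n := by
  classical
  have h1 := located_face_read a C M valid tight q j₀ hmax r h
  set T := {j : J // C ⬝ᵥ q j = C ⬝ᵥ q j₀} with hT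
  let e : T ≃ Fin (Fintype.card T) := Fintype.equivFin T
  have hK : 0 < Fintype.card T := Fintype.card_pos_iff.mpr ⟨⟨j₀, rfl⟩⟩
  have hrange : Set.range (fun j : T => delRead n a (q j.1 - q j₀)) =
      Set.range ((fun j : T => delRead n a (q j.1 - q j₀)) ∘ e.symm) :=
    (e.symm.surjective.range_comp _).symm
  rw [hrange] at h1
  rw [Nat.card_eq_fintype_card]
  exact corPolytopeGraph_top_add_hull_three_pow_le _ hK h1

/-! ## §9 The (half-)MOVE-STABLE form (P-P2c): the read fibre is a DILATE of `COR(K_n)` — `COR + λ·COR + v` is as hard as `COR` -/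

/-- self-similar passengers cost nothing: `xc(COR(K_m) + (λ·COR(K_m) + v)) = xc(COR(K_m))` for `λ ≥ 0` (convexity: `COR + λ·COR =
(1+λ)·COR`, then un-translate and un-scale). -/
theorem hasEF_cor_of_selfSimilar {m : ℕ} (lam : ℝ) (hlam : 0 ≤ lam) (v : Fin m × Fin m → ℝ) (r : ℕ)
    (h : HasEFOfSize (corPolytopeGraph (⊤ : SimpleGraph (Fin m)) +
      (lam • corPolytopeGraph (⊤ : SimpleGraph (Fin m)) + {v})) r) :
    HasEFOfSize (corPolytopeGraph (⊤ : SimpleGraph (Fin m))) r := by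
  have hconv : Convex ℝ (corPolytopeGraph (⊤ : SimpleGraph (Fin m))) := by
    unfold corPolytopeGraph; exact convex_convexHull ℝ _
  have hsum : corPolytopeGraph (⊤ : SimpleGraph (Fin m)) + (lam • corPolytopeGraph (⊤ : SimpleGraph (Fin m)) + {v}) =
      (1 + lam) • corPolytopeGraph (⊤ : SimpleGraph (Fin m)) + {v} := by
    rw [← add_assoc, hconv.add_smul zero_le_one hlam, one_smul]
  rw [hsum, Set.add_singleton] at h
  have h2 := h.image_add_const (-v)
  rw [Set.image_image] at h2
  simp only [add_neg_cancel_right, Set.image_id'] at h2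
  have h3 := h2.image_linearMap ((1 + lam)⁻¹ • LinearMap.id)
  have hne : (1 + lam) ≠ 0 := by positivity
  have himg : ⇑((1 + lam)⁻¹ • (LinearMap.id : (Fin m × Fin m → ℝ) →ₗ[ℝ] (Fin m × Fin m → ℝ))) ''
      ((1 + lam) • corPolytopeGraph (⊤ : SimpleGraph (Fin m))) = corPolytopeGraph (⊤ : SimpleGraph (Fin m)) := by
    have hco : ⇑((1 + lam)⁻¹ • (LinearMap.id : (Fin m × Fin m → ℝ) →ₗ[ℝ] (Fin m × Fin m → ℝ))) =
        fun x => (1 + lam)⁻¹ • x := by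
      funext x; simp
    rw [hco, Set.image_smul, smul_smul, inv_mul_cancel₀ hne, one_smul]
  rwa [himg] at h3

/-- ★ **SELF-SIMILAR LOCATED RUNG** (the R-level datum «the `C`-face of `R = COR + Q` reads as a dilate-translate of `COR(K_n)`»): if the
deletion read of the `C`-fibre of the passenger is `λ·COR(K_n) + v`, `λ ≥ 0`, the instance is as hard as `COR(K_n)`.  This is the form that
survives val-idea-40's COR-absorbing normal-form move (which turns a one-point fibre into a translate of `F_a`, i.e. `λ = 1` after the read). -/
theorem switchLocated_selfSimilar_rung {J : Type} (a : Fin (n + 1)) (C : Fin (n + 1) × Fin (n + 1) → ℝ) (M : ℝ)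
    (valid : ∀ b : Fin (n + 1) → Bool, C ⬝ᵥ corVec (⊤ : SimpleGraph (Fin (n + 1))) b ≤ M)
    (tight : ∀ b : Fin (n + 1) → Bool, C ⬝ᵥ corVec (⊤ : SimpleGraph (Fin (n + 1))) b = M ↔ b a = true)
    (q : J → (Fin (n + 1) × Fin (n + 1) → ℝ)) (j₀ : J) (hmax : ∀ j, C ⬝ᵥ q j ≤ C ⬝ᵥ q j₀)
    (lam : ℝ) (hlam : 0 ≤ lam) (v : Fin n × Fin n → ℝ)
    (hfib : convexHull ℝ (Set.range fun j : {j : J // C ⬝ᵥ q j = C ⬝ᵥ q j₀} => delRead n a (q j.1 - q j₀)) =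
      lam • corPolytopeGraph (⊤ : SimpleGraph (Fin n)) + {v}) (r : ℕ)
    (h : HasEFOfSize (corPolytopeGraph (⊤ : SimpleGraph (Fin (n + 1))) + convexHull ℝ (Set.range q)) r) :
    HasEFOfSize (corPolytopeGraph (⊤ : SimpleGraph (Fin n))) r := by
  have h1 := located_face_read a C M valid tight q j₀ hmax r h
  rw [hfib] at h1
  exact hasEF_cor_of_selfSimilar lam hlam v r h1

end Summit.ValiantsHypothesis.ValiantsHypothesis.Theorems.FifoMatching.SwitchFace

end
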